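import Summits.MatrixMultiplication.OmegaCensus.SmallFormats.MatMul22nLoadedPlaneStructure
import HarnessLib

/-!
# ω-census family (a): Brent's equations at a fixed point `X₀` as a matrix identity, and the INV-layer rank bound (any field)

Cell `pub-omega` (unit `pub-omega-tensor`, gen 40), topic `Summits/MatrixMultiplication/OmegaCensus` (sub-folder
`SmallFormats`). Framing (verbatim): lottery ticket; floor = certified bounds/negative ranges. HONEST FRAMING: M1-LEAN-BLUEPRINT F5 (memo DEFLATION-g40
§5): for a computation `β` of `⟨2,2,n⟩` and a point `X₀ ∈ k^{2×2}`, the `(2n) × (2n)` matrix `T(X₀)[(q,i),(p,i')] = X₀ p q · [i = i']` of the bilinear form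
`(Y, ζ) ↦ ⟨ζ, X₀Y⟩` equals `∑_t f_t(X₀) · vec(G_t) vec(W_t)ᵀ` (`BrentAtPoint.pointMatrix_eq_sum`); hence for any set `A` of terms,
`T(X₀) − ∑_{t∈A} f_t(X₀) vec(G_t) vec(W_t)ᵀ` has rank at most the number of terms outside `A` with `f_t(X₀) ≠ 0` (`rank_sub_sum_le`). Also `T(X) T(X') = T(X'X)`, so
`T(X₀)` is invertible with `T(X₀)⁻¹ = T(X₀⁻¹)` when `X₀` is. Matrices are written as explicit lambdas (no definitions). Nothing here is a bound on `ω`.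
-/

namespace Summit.MatrixMultiplication.OmegaCensus.SmallFormats

open Finset Module Matrix
open Literature.Computability.AlgebraicComplexity

namespace BrentAtPoint

variable {k : Type*} [Field k] {n : ℕ} {ι : Type*} [Fintype ι]

/-- **Brent at `X₀` as a matrix identity**: `T(X₀) = ∑_t f_t(X₀) · vec(G_t) vec(W_t)ᵀ`, indices `(q,i)` (Y-side) × `(p,i')` (output side). -/
theorem pointMatrix_eq_sum (β : BilinComp (mulBilin k 2 2 n) ι) (X₀ : Matrix (Fin 2) (Fin 2) k) :
    (Matrix.of fun (a : Fin 2 × Fin n) (b : Fin 2 × Fin n) => X₀ b.1 a.1 * (if a.2 = b.2 then (1 : k) else 0)) =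
      ∑ t, β.f t X₀ • Matrix.vecMulVec (fun a : Fin 2 × Fin n => β.g t (Matrix.single a.1 a.2 (1 : k)))
        (fun b : Fin 2 × Fin n => β.w t b.1 b.2) := by
  ext a b
  have h := β.map_eq_sum X₀ (Matrix.single a.1 a.2 (1 : k))
  rw [mulBilin_apply] at h
  have h' := congrFun (congrFun h b.1) b.2
  rw [mul_single_apply'] at h'
  rw [Matrix.of_apply, Matrix.sum_apply]
  simp only [Matrix.smul_apply, Matrix.vecMulVec_apply, smul_eq_mul]
  rw [Matrix.sum_apply] at h'
  simp only [Matrix.smul_apply, smul_eq_mul] at h'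
  rw [show (∑ x, β.f x X₀ * (β.g x (Matrix.single a.1 a.2 (1 : k)) * β.w x b.1 b.2)) =
      ∑ x, β.f x X₀ * β.g x (Matrix.single a.1 a.2 (1 : k)) * β.w x b.1 b.2 from
    Finset.sum_congr rfl fun x _ => (mul_assoc _ _ _).symm, ← h']
  by_cases hab : a.2 = b.2
  · simp [hab]
  · simp [hab, Ne.symm hab]

omit [Fintype ι] in
/-- `T(X) T(X') = T(X'X)`. -/
theorem pointMatrix_mul (X X' : Matrix (Fin 2) (Fin 2) k) :
    (Matrix.of fun (a : Fin 2 × Fin n) (b : Fin 2 × Fin n) => X b.1 a.1 * (if a.2 = b.2 then (1 : k) else 0)) *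
      (Matrix.of fun (a : Fin 2 × Fin n) (b : Fin 2 × Fin n) => X' b.1 a.1 * (if a.2 = b.2 then (1 : k) else 0)) =
      Matrix.of fun (a : Fin 2 × Fin n) (b : Fin 2 × Fin n) => (X' * X) b.1 a.1 * (if a.2 = b.2 then (1 : k) else 0) := by
  ext a c
  rw [Matrix.mul_apply, Matrix.of_apply, Matrix.mul_apply, Fintype.sum_prod_type]
  simp only [Matrix.of_apply]
  rw [Finset.sum_comm]
  rw [Finset.sum_eq_single a.2]
  · simp only [if_true, mul_one, Finset.sum_mul]
    refine Finset.sum_congr rfl fun b1 _ => by ring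
  · intro j _ hj
    simp [Ne.symm hj]
  · intro h; exact absurd (Finset.mem_univ _) h

omit [Fintype ι] in
/-- `T(1) = 1`. -/
theorem pointMatrix_one :
    (Matrix.of fun (a : Fin 2 × Fin n) (b : Fin 2 × Fin n) => (1 : Matrix (Fin 2) (Fin 2) k) b.1 a.1 * (if a.2 = b.2 then (1 : k) else 0)) = 1 := by
  ext a b
  rw [Matrix.of_apply, Matrix.one_apply, Matrix.one_apply]
  by_cases h : a = b
  · subst h; simp
  · have : ¬ (b.1 = a.1 ∧ a.2 = b.2) := fun hh => h (Prod.ext hh.1.symm hh.2)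
    by_cases h1 : b.1 = a.1
    · have h2 : a.2 ≠ b.2 := fun h2 => this ⟨h1, h2⟩
      simp [h1, h2, h]
    · simp [h1, h]

omit [Fintype ι] in
/-- `T(X₀)` is invertible when `X₀` is, with inverse `T(X₀⁻¹)`. -/
theorem pointMatrix_mul_inv (X₀ : Matrix (Fin 2) (Fin 2) k) (hX : IsUnit X₀.det) :
    (Matrix.of fun (a : Fin 2 × Fin n) (b : Fin 2 × Fin n) => X₀ b.1 a.1 * (if a.2 = b.2 then (1 : k) else 0)) *
      (Matrix.of fun (a : Fin 2 × Fin n) (b : Fin 2 × Fin n) => X₀⁻¹ b.1 a.1 * (if a.2 = b.2 then (1 : k) else 0)) = 1 := by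
  rw [pointMatrix_mul, Matrix.nonsing_inv_mul X₀ hX, pointMatrix_one]

omit [Fintype ι] in
/-- Hence `det T(X₀)` is a unit. -/
theorem isUnit_det_pointMatrix (X₀ : Matrix (Fin 2) (Fin 2) k) (hX : IsUnit X₀.det) :
    IsUnit (Matrix.of fun (a : Fin 2 × Fin n) (b : Fin 2 × Fin n) => X₀ b.1 a.1 * (if a.2 = b.2 then (1 : k) else 0)).det := by
  have h := pointMatrix_mul_inv (n := n) X₀ hX
  have hd := congrArg Matrix.det h
  rw [Matrix.det_mul, Matrix.det_one] at hd
  exact isUnit_iff_ne_zero.mpr fun h0 => by rw [h0, zero_mul] at hd; exact zero_ne_one hd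

omit [Fintype ι] in
/-- `rank(A + B) ≤ rank A + rank B` for matrices over a field. -/
theorem matrix_rank_add_le {m' n' : Type*} [Fintype m'] [Fintype n'] [DecidableEq n'] (A B : Matrix m' n' k) :
    (A + B).rank ≤ A.rank + B.rank := by
  rw [Matrix.rank, Matrix.rank, Matrix.rank, Matrix.mulVecLin_add]
  exact (Submodule.finrank_mono (LinearMap.range_add_le _ _)).trans (Submodule.finrank_add_le_finrank_add_finrank _ _)

omit [Fintype ι] in
/-- Rank is subadditive over finite sums. -/
theorem matrix_rank_sum_le {m' n' : Type*} [Fintype m'] [Fintype n'] [DecidableEq n'] {σ : Type*} (s : Finset σ)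
    (F : σ → Matrix m' n' k) : (∑ x ∈ s, F x).rank ≤ ∑ x ∈ s, (F x).rank := by
  classical
  induction s using Finset.induction_on with
  | empty => simp [Matrix.rank_zero]
  | insert a s ha ih =>
    rw [Finset.sum_insert ha, Finset.sum_insert ha]
    exact (matrix_rank_add_le _ _).trans (by omega)

open scoped Classical in
/-- **The INV-layer rank bound.** For any set `A` of terms, `T(X₀) − ∑_{t∈A} f_t(X₀) vec(G_t)vec(W_t)ᵀ = ∑_{t∉A} …`, whose rank is at most the number of
terms outside `A` with `f_t(X₀) ≠ 0`. -/
theorem rank_sub_sum_le (β : BilinComp (mulBilin k 2 2 n) ι) (X₀ : Matrix (Fin 2) (Fin 2) k) (A : Finset ι) :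
    ((Matrix.of fun (a : Fin 2 × Fin n) (b : Fin 2 × Fin n) => X₀ b.1 a.1 * (if a.2 = b.2 then (1 : k) else 0)) -
      ∑ t ∈ A, β.f t X₀ • Matrix.vecMulVec (fun a : Fin 2 × Fin n => β.g t (Matrix.single a.1 a.2 (1 : k)))
        (fun b : Fin 2 × Fin n => β.w t b.1 b.2)).rank ≤
      ((Finset.univ \ A).filter fun t => β.f t X₀ ≠ 0).card := by
  classical
  rw [pointMatrix_eq_sum β X₀]
  have hsplit : ∑ t, β.f t X₀ • Matrix.vecMulVec (fun a : Fin 2 × Fin n => β.g t (Matrix.single a.1 a.2 (1 : k)))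
        (fun b : Fin 2 × Fin n => β.w t b.1 b.2) -
      ∑ t ∈ A, β.f t X₀ • Matrix.vecMulVec (fun a : Fin 2 × Fin n => β.g t (Matrix.single a.1 a.2 (1 : k)))
        (fun b : Fin 2 × Fin n => β.w t b.1 b.2) =
      ∑ t ∈ (Finset.univ \ A).filter (fun t => β.f t X₀ ≠ 0),
        β.f t X₀ • Matrix.vecMulVec (fun a : Fin 2 × Fin n => β.g t (Matrix.single a.1 a.2 (1 : k)))
          (fun b : Fin 2 × Fin n => β.w t b.1 b.2) := by
    rw [← Finset.sum_sdiff (Finset.subset_univ A), add_sub_cancel_right, Finset.sum_filter]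
    refine Finset.sum_congr rfl fun t _ => ?_
    by_cases h : β.f t X₀ = 0
    · simp [h]
    · simp [h]
  rw [hsplit]
  refine (matrix_rank_sum_le _ _).trans ?_
  rw [Finset.card_eq_sum_ones]
  refine Finset.sum_le_sum fun t _ => ?_
  rw [← Matrix.smul_vecMulVec]
  exact Matrix.rank_vecMulVec_le _ _

end BrentAtPoint

end Summit.MatrixMultiplication.OmegaCensus.SmallFormats
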